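import Summits.ValiantsHypothesis.ValiantsHypothesis.Theses.VPBoundarySquare
import HarnessLib

/-!
# VPBoundarySquare — the aside `CollapseDebordersPresentableOfGRH` holds (decomp-valiant lens 3, NODE v7 «NB-TRANSFER»)

Route item (rev 3): `CollapseDebordersPresentableOfGRH := ExtendedRiemannHypothesis → Bur24_thm_4_10_2 ℂ →
CollapseDebordersPresentable`. Proof = the NB-transfer chain, self-contained over the two Literature modules the
route file imports (the fuller kernel with the consequences K2/K3 and the rung `B_nb` is
`Theorems/VPBoundarySquareNbTransfer.lean`):

`VP = VNP ⟹ VP̄_ε ∩ p-fam ⊆ VNPnb^ℂ` (THEOREM `IsPresVPBarFamily.isVNPnbFamily`, Bhargav–Dwivedi–Saxena 2024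
Lemma 4.1 "exponential interpolation" in characteristic zero) `⊆ VPnb` (Bürgisser 2024 Thm 4.10(2) under GRH and the
collapse, named fact `Bur24_thm_4_10_2`) and `VPnb ∩ p-fam = VP` (`isVPnbFamily_iff_isPComputable`). 0 sorry.
Honest framing: a CONDITIONAL debordering theorem; nothing here bears on `VP ≠ VNP` itself.
-/

noncomputable section

set_option linter.dupNamespace false

namespace Summit.ValiantsHypothesis.ValiantsHypothesis.Theorems.VPBoundarySquareNbTransferHolds

open Literature.PNP Literature.Computability.AlgebraicComplexity
open Summit.ValiantsHypothesis.ValiantsHypothesis.Theses.VPBoundarySquare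

/-- **ASIDE CLOSED** (item 23488): GRH ∧ Bürgisser 2024 Thm 4.10(2) ⟹ the collapse `VP = VNP` de-borders the
presentable closure of `VP` on p-families. [cite: Burgisser2024Completeness, Thm. 4.10 (2)]
[cite: BhargavDwivediSaxena2024, Lemma 4.1 (p. 13)] -/
theorem collapseDebordersPresentableOfGRH_holds : CollapseDebordersPresentableOfGRH :=
  fun hGRH h410 hEq v f hpf hf =>
    ((isVPnbFamily_iff_isPComputable f).1 (h410 hGRH hEq v f (hf.isVNPnbFamily hpf))).2

/-- Pointwise form over the route's decls: under the same two hypotheses the attacked child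
`CollapseDebordersPresentable` (item 23458) holds. -/
theorem collapseDebordersPresentable_of_GRH
    (hGRH : Literature.NumberTheory.LFunctions.ExtendedRiemannHypothesis)
    (h410 : Bur24_thm_4_10_2 ℂ) : CollapseDebordersPresentable :=
  collapseDebordersPresentableOfGRH_holds hGRH h410

end Summit.ValiantsHypothesis.ValiantsHypothesis.Theorems.VPBoundarySquareNbTransferHolds

end
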